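import Literature.Analysis.Fourier.FractalUncertaintyFourierTools
import HarnessLib

/-!
# Fourier–convolution toolkit for BD18 §3.3 (Lemma 3.3 and Proposition 3.1)

Topic `Literature/Analysis/Fourier`. Small, fully proved lemmas used in the formalisation of
J. Bourgain, S. Dyatlov, *Spectral gaps without the pressure condition*, Ann. of Math. 187 (2018),
§3.3 (proof of Proposition 3.1 from Lemmas 3.1–3.3), in the "`g`-language" of
`FractalUncertaintyPrinciple.lean` (`f = 𝓕⁻ h`, `h ∈ L¹ ∩ L²`):

* `convolution_fourierInv_eq` — `ψ ⋆ 𝓕⁻ k = 𝓕⁻ (ψ̂ · k)` for `ψ, k ∈ L¹` (Fubini; this is the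
  identity `(f_η * ψ)^ = f̂_η ψ̂`, BD18 (2.3), read backwards);
* `fourierInv_comp_sub_right` — `𝓕⁻ (k(· - a))(x) = e^{2πiax} 𝓕⁻ k (x)` (BD18: `f̂_η(ξ) = f̂(ξ-η)` for
  `f_η = e^{2πiηx} f`);
* `fourier_fourierChar_mul` — `𝓕 (e^{-2πia·} ψ)(ξ) = ψ̂(ξ + a)`;
* `convolution_congr_local` — `(ψ ⋆ F)(x)` only depends on `F` on `x - supp ψ`
  (BD18 (3.13): `g_η = (1_{U'} f_η) * ψ` on `U''`);
* `convolution_fourierChar_mul` — `ψ ⋆ (e_a F) = e_a · ((e_{-a} ψ) ⋆ F)`;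
* `sum_setLIntegral_sq_convolution_le` — for a finite family `u_i ∈ L¹` vanishing off `[-1,1]` with
  `∑_i |û_i(ξ)|² ≤ B` and `F ∈ L² ∩ L^∞`: `∑_i ∫_{[-M,M]} |u_i ⋆ F|² ≤ B ‖F‖²_{L²}` for every `M`
  (Plancherel on `L¹ ∩ L²` applied to the truncations `1_{[-R,R]} F`; this replaces the `H^{-10}`
  bookkeeping of BD18 (3.19)).

All statements are folklore; no definitions are introduced.
-/

namespace Literature.Analysis.Fourier.Prop31

open _root_.MeasureTheory Set Function Filter
open scoped FourierTransform ENNReal Convolution Pointwise Real Topology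

/-- `‖𝐞 x‖ = 1` in `ℂ`. [folklore] -/
theorem norm_fourierChar (x : ℝ) : ‖((𝐞 x : Circle) : ℂ)‖ = 1 :=
  Circle.norm_coe _

/-- `𝐞 (a + b) = 𝐞 a * 𝐞 b` in `ℂ`. [folklore] -/
theorem fourierChar_add (a b : ℝ) : ((𝐞 (a + b) : Circle) : ℂ) = (𝐞 a : ℂ) * (𝐞 b : ℂ) := by
  rw [AddChar.map_add_eq_mul, Circle.coe_mul]

/-- **`ψ ⋆ 𝓕⁻ k = 𝓕⁻ (ψ̂ k)`** pointwise, for `ψ, k ∈ L¹(ℝ)` (Fubini). [folklore] -/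
theorem convolution_fourierInv_eq {ψ k : ℝ → ℂ} (hψ : Integrable ψ) (hk : Integrable k) (x : ℝ) :
    (ψ ⋆[ContinuousLinearMap.mul ℂ ℂ, volume] (𝓕⁻ k : ℝ → ℂ)) x =
      (𝓕⁻ (fun v => 𝓕 ψ v * k v) : ℝ → ℂ) x := by
  rw [convolution_def, fourierInv_real_eq]
  simp_rw [ContinuousLinearMap.mul_apply', fourierInv_real_eq, Real.fourier_real_eq,
    Circle.smul_def, smul_eq_mul]
  have key : ∀ t v : ℝ, ψ t * (((𝐞 (v * (x - t)) : Circle) : ℂ) * k v) =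
      ((𝐞 (v * x) : Circle) : ℂ) * ((((𝐞 (-(t * v)) : Circle) : ℂ) * ψ t) * k v) := by
    intro t v
    have : (((𝐞 (v * (x - t)) : Circle) : ℂ)) = (𝐞 (v * x) : ℂ) * (𝐞 (-(t * v)) : ℂ) := by
      rw [← fourierChar_add]
      congr 2
      ring
    rw [this]
    ring
  have hint : Integrable (uncurry fun t v => ψ t * (((𝐞 (v * (x - t)) : Circle) : ℂ) * k v))
      (volume.prod volume) := by
    have h1 : Integrable (fun p : ℝ × ℝ => ψ p.1 * k p.2) (volume.prod volume) := hψ.mul_prod hk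
    have h2 : Integrable (fun p : ℝ × ℝ => (((𝐞 (p.2 * (x - p.1)) : Circle) : ℂ)) * (ψ p.1 * k p.2))
        (volume.prod volume) := by
      refine h1.bdd_mul (c := 1) ?_ (Eventually.of_forall fun p => (norm_fourierChar _).le)
      have hc : Continuous fun p : ℝ × ℝ => (((𝐞 (p.2 * (x - p.1)) : Circle) : ℂ)) :=
        continuous_subtype_val.comp (Real.continuous_fourierChar.comp (by fun_prop))
      exact hc.aestronglyMeasurable
    refine h2.congr (Eventually.of_forall fun p => ?_)
    simp only [uncurry]
    ring
  calc ∫ t, ψ t * ∫ v, ((𝐞 (v * (x - t)) : Circle) : ℂ) * k v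
      = ∫ t, ∫ v, ψ t * (((𝐞 (v * (x - t)) : Circle) : ℂ) * k v) := by
        congr 1
        funext t
        rw [integral_const_mul]
    _ = ∫ v, ∫ t, ψ t * (((𝐞 (v * (x - t)) : Circle) : ℂ) * k v) := integral_integral_swap hint
    _ = ∫ v, ((𝐞 (v * x) : Circle) : ℂ) * ((∫ t, ((𝐞 (-(t * v)) : Circle) : ℂ) * ψ t) * k v) := by
        congr 1
        funext v
        simp_rw [key]
        rw [integral_const_mul, integral_mul_const]

/-- **Translation on the Fourier side is modulation**: `𝓕⁻ (k(· - a))(x) = 𝐞(a x) · 𝓕⁻ k (x)`.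
[folklore] -/
theorem fourierInv_comp_sub_right (k : ℝ → ℂ) (a x : ℝ) :
    (𝓕⁻ (fun v => k (v - a)) : ℝ → ℂ) x = ((𝐞 (a * x) : Circle) : ℂ) * (𝓕⁻ k : ℝ → ℂ) x := by
  rw [fourierInv_real_eq, fourierInv_real_eq]
  simp_rw [Circle.smul_def, smul_eq_mul]
  rw [← integral_add_right_eq_self (fun v => ((𝐞 (v * x) : Circle) : ℂ) * k (v - a)) a,
    ← integral_const_mul]
  congr 1
  funext v
  rw [add_sub_cancel_right, show (v + a) * x = a * x + v * x by ring, fourierChar_add]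
  ring

/-- **Modulation on the space side is translation**: `𝓕 (𝐞(-a·) ψ)(ξ) = ψ̂(ξ + a)`. [folklore] -/
theorem fourier_fourierChar_mul (ψ : ℝ → ℂ) (a ξ : ℝ) :
    𝓕 (fun t => ((𝐞 (-(a * t)) : Circle) : ℂ) * ψ t) ξ = 𝓕 ψ (ξ + a) := by
  rw [Real.fourier_real_eq, Real.fourier_real_eq]
  congr 1
  funext t
  simp_rw [Circle.smul_def, smul_eq_mul]
  rw [show -(t * (ξ + a)) = -(t * ξ) + -(a * t) by ring, fourierChar_add]
  ring

/-- **Locality of convolution**: if `ψ = 0` off `[-ρ, ρ]` and `F = F'` on `[x - ρ, x + ρ]` then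
`(ψ ⋆ F)(x) = (ψ ⋆ F')(x)`. [folklore] -/
theorem convolution_congr_local {ψ F F' : ℝ → ℂ} {ρ x : ℝ}
    (hψ : ∀ t, t ∉ Icc (-ρ) ρ → ψ t = 0) (hF : ∀ y ∈ Icc (x - ρ) (x + ρ), F y = F' y) :
    (ψ ⋆[ContinuousLinearMap.mul ℂ ℂ, volume] F) x =
      (ψ ⋆[ContinuousLinearMap.mul ℂ ℂ, volume] F') x := by
  simp only [convolution_def, ContinuousLinearMap.mul_apply']
  congr 1
  funext t
  by_cases ht : t ∈ Icc (-ρ) ρ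
  · rw [hF (x - t)]
    simp only [mem_Icc] at ht ⊢
    constructor <;> linarith [ht.1, ht.2]
  · rw [hψ t ht, zero_mul, zero_mul]

/-- **Modulation passes through convolution**: `ψ ⋆ (𝐞(a·) F) = 𝐞(a x) · ((𝐞(-a·) ψ) ⋆ F)`.
[folklore] -/
theorem convolution_fourierChar_mul (ψ F : ℝ → ℂ) (a x : ℝ) :
    (ψ ⋆[ContinuousLinearMap.mul ℂ ℂ, volume] fun y => ((𝐞 (a * y) : Circle) : ℂ) * F y) x =
      ((𝐞 (a * x) : Circle) : ℂ) *
        ((fun t => ((𝐞 (-(a * t)) : Circle) : ℂ) * ψ t) ⋆[ContinuousLinearMap.mul ℂ ℂ, volume] F) x := by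
  simp only [convolution_def, ContinuousLinearMap.mul_apply']
  rw [← integral_const_mul]
  congr 1
  funext t
  rw [show a * (x - t) = a * x + -(a * t) by ring, fourierChar_add]
  ring

/-- Norm form of `convolution_fourierChar_mul`: `|ψ ⋆ (𝐞(a·) F)| = |(𝐞(-a·) ψ) ⋆ F|`. [folklore] -/
theorem norm_convolution_fourierChar_mul (ψ F : ℝ → ℂ) (a x : ℝ) :
    ‖(ψ ⋆[ContinuousLinearMap.mul ℂ ℂ, volume] fun y => ((𝐞 (a * y) : Circle) : ℂ) * F y) x‖ =
      ‖((fun t => ((𝐞 (-(a * t)) : Circle) : ℂ) * ψ t) ⋆[ContinuousLinearMap.mul ℂ ℂ, volume] F) x‖ := by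
  rw [convolution_fourierChar_mul, norm_mul, norm_fourierChar, one_mul]

/-- `‖(u ⋆ g)(x)‖ ≤ ‖u‖_{L¹} ‖g‖_∞`. [folklore] -/
theorem norm_convolution_le' {u g : ℝ → ℂ} {C : ℝ} (hu : Integrable u) (hC : ∀ x, ‖g x‖ ≤ C)
    (x : ℝ) : ‖(u ⋆[ContinuousLinearMap.mul ℂ ℂ, volume] g) x‖ ≤ (∫ t, ‖u t‖) * C := by
  have hC0 : 0 ≤ C := (norm_nonneg _).trans (hC 0)
  rw [convolution_def]
  have hint : Integrable (fun t => ‖u t‖ * C) := hu.norm.mul_const C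
  calc ‖∫ t, (ContinuousLinearMap.mul ℂ ℂ) (u t) (g (x - t))‖
      ≤ ∫ t, ‖(ContinuousLinearMap.mul ℂ ℂ) (u t) (g (x - t))‖ := norm_integral_le_integral_norm _
    _ ≤ ∫ t, ‖u t‖ * C := by
        apply integral_mono_of_nonneg (Eventually.of_forall fun _ => norm_nonneg _) hint
        refine Eventually.of_forall fun t => ?_
        simp only [ContinuousLinearMap.mul_apply', norm_mul]
        exact mul_le_mul_of_nonneg_left (hC _) (norm_nonneg _)
    _ = (∫ t, ‖u t‖) * C := integral_mul_const _ _

/-- If `u ∈ L¹` vanishes off a bounded set `A` and `g` is bounded, integrable and vanishes off a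
bounded set `B`, then `u ⋆ g ∈ L¹ ∩ L²(ℝ)`. [folklore] -/
theorem integrable_and_memLp_two_convolution' {u g : ℝ → ℂ} {A B : Set ℝ} {C : ℝ}
    (hu : Integrable u) (hu0 : ∀ x, x ∉ A → u x = 0) (hA : Bornology.IsBounded A)
    (hg : Integrable g) (hC : ∀ x, ‖g x‖ ≤ C) (hg0 : ∀ x, x ∉ B → g x = 0)
    (hB : Bornology.IsBounded B) :
    Integrable (u ⋆[ContinuousLinearMap.mul ℂ ℂ, volume] g) ∧
      MemLp (u ⋆[ContinuousLinearMap.mul ℂ ℂ, volume] g) 2 volume := by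
  have hint : Integrable (u ⋆[ContinuousLinearMap.mul ℂ ℂ, volume] g) :=
    hu.integrable_convolution _ hg
  refine ⟨hint, ?_⟩
  have htop : MemLp (u ⋆[ContinuousLinearMap.mul ℂ ℂ, volume] g) ∞ volume :=
    memLp_top_of_bound hint.aestronglyMeasurable ((∫ t, ‖u t‖) * C)
      (Eventually.of_forall (norm_convolution_le' hu hC))
  exact htop.mono_exponent_of_measure_support_ne_top
    (fun ξ hξ => convolution_eq_zero_of_notMem_add hu0 hg0 hξ) (hA.add hB).measure_lt_top.ne le_top

/-- `‖z‖ₑ ^ 2 = ENNReal.ofReal (‖z‖ ^ 2)`. [folklore] -/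
theorem enorm_sq_eq_ofReal (z : ℂ) : ‖z‖ₑ ^ 2 = ENNReal.ofReal (‖z‖ ^ 2) := by
  rw [← ofReal_norm, ENNReal.ofReal_pow (norm_nonneg _)]

/-- **A finite family of convolution operators with `∑ |û_i|² ≤ B` is `√B`-bounded on `L²`,
window by window.** Let `u_i ∈ L¹(ℝ)` (`i ∈ s`, finite) vanish off `[-1, 1]` with
`∑_{i ∈ s} |û_i(ξ)|² ≤ B` for all `ξ`, and let `F ∈ L²(ℝ)` be bounded. Then for every `M`,
`∑_{i ∈ s} ∫_{[-M,M]} |(u_i ⋆ F)(x)|² dx ≤ B ∫ |F|²`. (Proof: on `[-M, M]`, `u_i ⋆ F = u_i ⋆ F_R`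
with `F_R = 1_{[-R,R]} F ∈ L¹ ∩ L²`, `R = M + 1`; then Plancherel on `L¹ ∩ L²` and
`(u_i ⋆ F_R)^ = û_i F̂_R`.) [folklore] -/
theorem sum_setLIntegral_sq_convolution_le {ι : Type*} (s : Finset ι) {u : ι → ℝ → ℂ}
    {F : ℝ → ℂ} {B C : ℝ} (hu : ∀ i ∈ s, Integrable (u i))
    (hu0 : ∀ i ∈ s, ∀ t, t ∉ Icc (-1 : ℝ) 1 → u i t = 0)
    (hB : ∀ ξ, ∑ i ∈ s, ‖𝓕 (u i) ξ‖ ^ 2 ≤ B) (hF2 : MemLp F 2 volume) (hC : ∀ y, ‖F y‖ ≤ C)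
    (M : ℝ) :
    ∑ i ∈ s, ∫⁻ x in Icc (-M) M, ‖(u i ⋆[ContinuousLinearMap.mul ℂ ℂ, volume] F) x‖ₑ ^ 2 ≤
      ENNReal.ofReal B * ∫⁻ y, ‖F y‖ₑ ^ 2 := by
  have hB0 : 0 ≤ B := le_trans (Finset.sum_nonneg fun i _ => by positivity) (hB 0)
  set R : ℝ := M + 1 with hR
  set FR : ℝ → ℂ := (Icc (-R) R).indicator F with hFR
  have hFR2 : MemLp FR 2 volume := hF2.indicator measurableSet_Icc
  have hFRb : ∀ y, ‖FR y‖ ≤ C := by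
    intro y
    rw [hFR]
    by_cases hy : y ∈ Icc (-R) R
    · rw [indicator_of_mem hy]; exact hC y
    · rw [indicator_of_notMem hy, norm_zero]; exact (norm_nonneg _).trans (hC 0)
  have hFR0 : ∀ y, y ∉ Icc (-R) R → FR y = 0 := fun y hy => indicator_of_notMem hy _
  have hFR1 : Integrable FR :=
    integrable_of_bounded_of_vanish hFR2.1 hFRb hFR0 (Metric.isBounded_Icc _ _)
  -- Plancherel for each `u_i ⋆ F_R`
  have hconv : ∀ i ∈ s, Integrable (u i ⋆[ContinuousLinearMap.mul ℂ ℂ, volume] FR) ∧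
      MemLp (u i ⋆[ContinuousLinearMap.mul ℂ ℂ, volume] FR) 2 volume := fun i hi =>
    integrable_and_memLp_two_convolution' (hu i hi) (hu0 i hi) (Metric.isBounded_Icc _ _) hFR1 hFRb
      hFR0 (Metric.isBounded_Icc _ _)
  -- Step 1: on `[-M, M]`, `u_i ⋆ F = u_i ⋆ F_R`
  have hloc : ∀ i ∈ s, ∀ x ∈ Icc (-M) M, (u i ⋆[ContinuousLinearMap.mul ℂ ℂ, volume] F) x =
      (u i ⋆[ContinuousLinearMap.mul ℂ ℂ, volume] FR) x := by
    intro i hi x hx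
    refine convolution_congr_local (ρ := 1) (hu0 i hi) fun y hy => ?_
    rw [hFR, indicator_of_mem]
    simp only [mem_Icc] at hx hy ⊢
    constructor <;> linarith [hy.1, hy.2, hx.1, hx.2]
  have hstep1 : ∀ i ∈ s, ∫⁻ x in Icc (-M) M, ‖(u i ⋆[ContinuousLinearMap.mul ℂ ℂ, volume] F) x‖ₑ ^ 2
      ≤ ∫⁻ x, ‖(u i ⋆[ContinuousLinearMap.mul ℂ ℂ, volume] FR) x‖ₑ ^ 2 := by
    intro i hi
    calc ∫⁻ x in Icc (-M) M, ‖(u i ⋆[ContinuousLinearMap.mul ℂ ℂ, volume] F) x‖ₑ ^ 2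
        = ∫⁻ x in Icc (-M) M, ‖(u i ⋆[ContinuousLinearMap.mul ℂ ℂ, volume] FR) x‖ₑ ^ 2 := by
          apply setLIntegral_congr_fun measurableSet_Icc
          intro x hx
          simp only [hloc i hi x hx]
      _ ≤ ∫⁻ x, ‖(u i ⋆[ContinuousLinearMap.mul ℂ ℂ, volume] FR) x‖ₑ ^ 2 :=
          setLIntegral_le_lintegral _ _
  -- Step 2: Plancherel and the convolution theorem
  have hstep2 : ∀ i ∈ s, ∫⁻ x, ‖(u i ⋆[ContinuousLinearMap.mul ℂ ℂ, volume] FR) x‖ₑ ^ 2 =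
      ∫⁻ ξ, ‖𝓕 (u i) ξ‖ₑ ^ 2 * ‖𝓕 FR ξ‖ₑ ^ 2 := by
    intro i hi
    rw [← Literature.Analysis.FunctionSpaces.lintegral_enorm_sq_fourierIntegral_eq (hconv i hi).1
      (hconv i hi).2]
    congr 1
    funext ξ
    rw [Real.fourier_mul_convolution_eq (hu i hi) hFR1, enorm_mul, mul_pow]
  calc ∑ i ∈ s, ∫⁻ x in Icc (-M) M, ‖(u i ⋆[ContinuousLinearMap.mul ℂ ℂ, volume] F) x‖ₑ ^ 2
      ≤ ∑ i ∈ s, ∫⁻ ξ, ‖𝓕 (u i) ξ‖ₑ ^ 2 * ‖𝓕 FR ξ‖ₑ ^ 2 :=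
        Finset.sum_le_sum fun i hi => (hstep1 i hi).trans (hstep2 i hi).le
    _ = ∫⁻ ξ, (∑ i ∈ s, ‖𝓕 (u i) ξ‖ₑ ^ 2) * ‖𝓕 FR ξ‖ₑ ^ 2 := by
        rw [← lintegral_finsetSum']
        · congr 1
          funext ξ
          rw [Finset.sum_mul]
        · intro i hi
          exact ((Literature.Analysis.FunctionSpaces.continuous_fourierIntegral (hu i hi)).measurable.enorm.pow_const _).aemeasurable.mul
            ((Literature.Analysis.FunctionSpaces.continuous_fourierIntegral hFR1).measurable.enorm.pow_const _).aemeasurable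
    _ ≤ ∫⁻ ξ, ENNReal.ofReal B * ‖𝓕 FR ξ‖ₑ ^ 2 := by
        apply lintegral_mono
        intro ξ
        apply mul_le_mul_left
        have : ∑ i ∈ s, ‖𝓕 (u i) ξ‖ₑ ^ 2 = ENNReal.ofReal (∑ i ∈ s, ‖𝓕 (u i) ξ‖ ^ 2) := by
          rw [ENNReal.ofReal_sum_of_nonneg fun i _ => by positivity]
          exact Finset.sum_congr rfl fun i _ => enorm_sq_eq_ofReal _
        rw [this]
        exact ENNReal.ofReal_le_ofReal (hB ξ)
    _ = ENNReal.ofReal B * ∫⁻ ξ, ‖𝓕 FR ξ‖ₑ ^ 2 := by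
        rw [lintegral_const_mul']
        exact ENNReal.ofReal_ne_top
    _ = ENNReal.ofReal B * ∫⁻ y, ‖FR y‖ₑ ^ 2 := by
        rw [Literature.Analysis.FunctionSpaces.lintegral_enorm_sq_fourierIntegral_eq hFR1 hFR2]
    _ ≤ ENNReal.ofReal B * ∫⁻ y, ‖F y‖ₑ ^ 2 := by
        gcongr with y
        rw [hFR]
        by_cases hy : y ∈ Icc (-R) R
        · rw [indicator_of_mem hy]
        · rw [indicator_of_notMem hy]; simp

end Literature.Analysis.Fourier.Prop31
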